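import Summits.CriticalPhenomena.PercolationContinuityZ3.Theorems.PercNearOneGluingNoHeavyLowerTailThreePointVarianceRefutationGadget
import Summits.CriticalPhenomena.PercolationContinuityZ3.Theorems.PercNearOneGluingNoHeavyLowerTailThreePointVarianceRefutationPieceMap
import HarnessLib

/-!
# The counterexample graph for the three-point variance row `(3PT)`: `2⁶⁴` parallel copies of the gadget `G₄(1/150,1/150)`

Support file for crux `stmt-CriticalPhenomena-4575` (`NoHeavyLowerTail`, closed), seat `prim-nh-lead-4575` gen 114
(`--supports stmt-CriticalPhenomena-4575`); fifth of the files refuting `(3PT)` (prim-l12-p6 gen 22's counterexample family, memo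
`run/shared/lean/prim/prim-l12/FROM-prim-l12-p6-g22-3PT-REFUTED.md`).  THE GRAPH [this work]: vertex type `VV = Fin 3 ⊕ (Fin 2⁶⁴ × Fin 4)` —
terminals `a b c` (`ta tb tc`) and, for each of `2⁶⁴` copies, four hubs; the chart `emb j : Fin 7 → VV` of copy `j` sends the gadget's terminals
`0 1 2` to `a b c` and its hubs `3..6` to the hubs of copy `j`; the weight `wt` is the gadget weight (`…RefutationGadget.gad.w`, read through the
projection `proj : VV → Fin 7`) on pairs inside one copy (or touching a terminal) and `0` between different copies — a parallel composition at `a, b, c`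
in the sense of prim-l12-p1 gen 20's `ThreePointPieces` (`wt_cross`), with `wt ∘ Sym2.map (emb j) = gad.w` (`wt_map_emb`) and terminal pairs of weight `0`
(`wt_ab`, `wt_ac`, `wt_bc`); `chart : IsPieceChart ta tb tc part T7 emb` (generic piece charts of `…RefutationPieceMap`).  Everything here is kept free
of `Finset`-membership statements over `VV` (their normal forms would unfold `Finset.univ` of `VV`).  The probabilities and the refutation itself are in
`…ThreePointVarianceRefutation.lean`.  No named facts, no sorries, standard axioms.
-/

namespace Summit.CriticalPhenomena.PercolationContinuityZ3.Theorems.ThreePointVarianceRefutation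

open MeasureTheory Set Literature.Probability.Percolation Literature.Probability.LatticeModels
open Summit.CriticalPhenomena.PercolationContinuityZ3.Theorems.ThreePointPieces
open Summit.CriticalPhenomena.PercolationContinuityZ3.Theorems.ThreePointHubEvents (tClosed real_tClosed real_tClosed_inter)

/-! ## The vertex type, terminals, copies, charts -/

/-- The copy index type: `2⁶⁴` copies. [this work] -/
abbrev Cp : Type := Fin 18446744073709551616

/-- `|Cp| = 2⁶⁴`. [this work] -/
theorem card_Cp : Fintype.card Cp = 2 ^ 64 := by
  rw [Fintype.card_fin]; norm_num

/-- The vertex type: three terminals and four hubs per copy. [this work] -/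
abbrev VV : Type := Fin 3 ⊕ (Cp × Fin 4)

/-- Terminal `a`. [this work] -/
def ta : VV := Sum.inl 0
/-- Terminal `b`. [this work] -/
def tb : VV := Sum.inl 1
/-- Terminal `c`. [this work] -/
def tc : VV := Sum.inl 2

/-- `a ≠ b`. [this work] -/
theorem ta_ne_tb : ta ≠ tb := by decide
/-- `a ≠ c`. [this work] -/
theorem ta_ne_tc : ta ≠ tc := by decide
/-- `b ≠ c`. [this work] -/
theorem tb_ne_tc : tb ≠ tc := by decide

/-- Every `inl` vertex is a terminal. [this work] -/
theorem inl_mem_terms (t : Fin 3) : (Sum.inl t : VV) ∈ terms ta tb tc := by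
  fin_cases t <;> simp [mem_terms, ta, tb, tc]

/-- No `inr` vertex is a terminal. [this work] -/
theorem inr_not_mem_terms (ji : Cp × Fin 4) : (Sum.inr ji : VV) ∉ terms ta tb tc := by
  simp [mem_terms, ta, tb, tc]

/-- The piece labelling: the copy index (terminals get the irrelevant label `0`). [this work] -/
def part : VV → Cp
  | Sum.inl _ => 0
  | Sum.inr ji => ji.1

/-- Projection to the gadget's vertex set `Fin 7`: terminals `↦ 0, 1, 2`, hub `i` of any copy `↦ 3 + i`. [this work] -/
def proj : VV → Fin 7
  | Sum.inl t => ⟨t, by have := t.isLt; omega⟩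
  | Sum.inr ji => ⟨ji.2 + 3, by have := ji.2.isLt; omega⟩

/-- The "terminal index" predicate of the model `Fin 7`: indices `< 3`. [this work] -/
abbrev T7 : Fin 7 → Prop := fun p => (p : ℕ) < 3

/-- The chart of copy `j`: gadget vertex `p < 3 ↦` terminal `p`, `p ≥ 3 ↦` hub `p − 3` of copy `j`. [this work] -/
def emb (j : Cp) (p : Fin 7) : VV :=
  if h : (p : ℕ) < 3 then Sum.inl ⟨p, h⟩ else Sum.inr (j, ⟨p - 3, by have := p.isLt; omega⟩)

/-- `proj ∘ emb j = id`. [this work] -/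
theorem proj_emb (j : Cp) (p : Fin 7) : proj (emb j p) = p := by
  unfold emb
  split_ifs with h
  · ext; simp [proj]
  · ext; simp [proj]; omega

/-- `emb j` is injective. [this work] -/
theorem emb_injective (j : Cp) : Function.Injective (emb j) :=
  Function.LeftInverse.injective (proj_emb j)

/-- `emb j 0 = a`. [this work] -/
theorem emb_zero (j : Cp) : emb j 0 = ta := by
  unfold emb; rw [dif_pos (show ((0 : Fin 7) : ℕ) < 3 by decide)]; rfl
/-- `emb j 1 = b`. [this work] -/
theorem emb_one (j : Cp) : emb j 1 = tb := by
  unfold emb; rw [dif_pos (show ((1 : Fin 7) : ℕ) < 3 by decide)]; rfl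
/-- `emb j 2 = c`. [this work] -/
theorem emb_two (j : Cp) : emb j 2 = tc := by
  unfold emb; rw [dif_pos (show ((2 : Fin 7) : ℕ) < 3 by decide)]; rfl

/-- `emb j p` is a terminal iff `p < 3`. [this work] -/
theorem emb_mem_terms_iff (j : Cp) (p : Fin 7) : emb j p ∈ terms ta tb tc ↔ T7 p := by
  unfold emb
  split_ifs with h
  · exact iff_of_true (inl_mem_terms _) h
  · exact iff_of_false (inr_not_mem_terms _) h

/-- Non-terminal images lie in piece `j`. [this work] -/
theorem part_emb (j : Cp) (p : Fin 7) (h : ¬ T7 p) : part (emb j p) = j := by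
  unfold emb; rw [dif_neg h]; rfl

/-- `emb j` on a terminal index. [this work] -/
theorem emb_castLE (j : Cp) (t : Fin 3) : emb j (t.castLE (by norm_num)) = Sum.inl t := by
  unfold emb; rw [dif_pos (by exact t.isLt)]; rfl

/-- `emb j` on a hub index. [this work] -/
theorem emb_hub (j : Cp) (i : Fin 4) : emb j ⟨i + 3, by have := i.isLt; omega⟩ = Sum.inr (j, i) := by
  unfold emb
  rw [dif_neg (by simp)]
  rcases i with ⟨i, hi⟩
  simp

/-- **The charts `emb j` form a piece chart** for the terminals `a, b, c`, the labelling `part` and the terminal predicate `T7`. [this work] -/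
theorem chart : IsPieceChart ta tb tc part T7 emb where
  inj := emb_injective
  term_iff := emb_mem_terms_iff
  part_eq := part_emb
  surj_piece := by
    rintro j (t | ⟨j', i⟩) hu hpu
    · exact absurd (inl_mem_terms t) hu
    · have hj : j' = j := hpu
      subst hj
      exact ⟨⟨i + 3, by have := i.isLt; omega⟩, emb_hub j' i⟩
  surj_term := by
    rintro j (t | ji) hu
    · exact ⟨t.castLE (by norm_num), emb_castLE j t⟩
    · exact absurd hu (inr_not_mem_terms ji)

/-! ## The weights -/

/-- Two vertices are compatible (same copy, or one of them a terminal). [this work] -/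
def compat : VV → VV → Bool
  | Sum.inr ji, Sum.inr ji' => decide (ji.1 = ji'.1)
  | _, _ => true

/-- `compat` is symmetric. [this work] -/
theorem compat_comm (u v : VV) : compat u v = compat v u := by
  rcases u with _ | ⟨j, i⟩ <;> rcases v with _ | ⟨j', i'⟩ <;> simp [compat, eq_comm]

/-- Images of one chart are compatible. [this work] -/
theorem compat_emb (j : Cp) (p q : Fin 7) : compat (emb j p) (emb j q) = true := by
  unfold emb; split_ifs <;> simp [compat]

/-- **The weight function of the counterexample**: gadget weights inside each copy (read through `proj`), `0` between different copies.
[this work] -/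
noncomputable def wt : Sym2 VV → unitInterval :=
  Sym2.lift ⟨fun u v => if compat u v = true then gad.w s(proj u, proj v) else 0, fun u v => by
    show (if compat u v = true then gad.w s(proj u, proj v) else 0) =
      (if compat v u = true then gad.w s(proj v, proj u) else 0)
    rw [compat_comm u v, Sym2.eq_swap]⟩

/-- `wt` on a pair. [this work] -/
theorem wt_mk (u v : VV) : wt s(u, v) = if compat u v = true then gad.w s(proj u, proj v) else 0 := rfl

/-- **Each copy carries exactly the gadget's weights**: `wt ∘ Sym2.map (emb j) = gad.w`. [this work] -/
theorem wt_map_emb (j : Cp) (e : Sym2 (Fin 7)) : wt (Sym2.map (emb j) e) = gad.w e := by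
  induction e using Sym2.ind with
  | h p q => rw [Sym2.map_mk, wt_mk, if_pos (compat_emb j p q), proj_emb, proj_emb]

/-- Function form of `wt_map_emb`. [this work] -/
theorem wt_comp_emb (j : Cp) : wt ∘ Sym2.map (emb j) = gad.w := funext (wt_map_emb j)

/-- **Parallel composition**: pairs between non-terminals of different copies have weight `0`. [this work] -/
theorem wt_cross (u v : VV) (hu : u ∉ terms ta tb tc) (hv : v ∉ terms ta tb tc) (h : part u ≠ part v) :
    (wt s(u, v) : ℝ) = 0 := by
  rcases u with t | ⟨j, i⟩
  · exact absurd (inl_mem_terms t) hu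
  rcases v with t' | ⟨j', i'⟩
  · exact absurd (inl_mem_terms t') hv
  have hc : compat (Sum.inr (j, i)) (Sum.inr (j', i')) = false := by simpa [compat, part] using h
  rw [wt_mk, hc]; simp

/-- The three terminal pairs are not listed pairs of the gadget. [this work] -/
theorem termPairs_unlisted : ∀ i : Fin 9, gad.edge i ≠ s(0, 1) ∧ gad.edge i ≠ s(0, 2) ∧ gad.edge i ≠ s(1, 2) := by decide

/-- `w(ab) = 0`. [this work] -/
theorem wt_ab : (wt s(ta, tb) : ℝ) = 0 := by
  have h : s(ta, tb) = Sym2.map (emb 0) s(0, 1) := by rw [Sym2.map_mk, emb_zero, emb_one]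
  rw [h, wt_map_emb]
  exact FK.RCEval.w_eq_zero_of_notMem_range fun ⟨i, hi⟩ => (termPairs_unlisted i).1 hi
/-- `w(ac) = 0`. [this work] -/
theorem wt_ac : (wt s(ta, tc) : ℝ) = 0 := by
  have h : s(ta, tc) = Sym2.map (emb 0) s(0, 2) := by rw [Sym2.map_mk, emb_zero, emb_two]
  rw [h, wt_map_emb]
  exact FK.RCEval.w_eq_zero_of_notMem_range fun ⟨i, hi⟩ => (termPairs_unlisted i).2.1 hi
/-- `w(bc) = 0`. [this work] -/
theorem wt_bc : (wt s(tb, tc) : ℝ) = 0 := by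
  have h : s(tb, tc) = Sym2.map (emb 0) s(1, 2) := by rw [Sym2.map_mk, emb_one, emb_two]
  rw [h, wt_map_emb]
  exact FK.RCEval.w_eq_zero_of_notMem_range fun ⟨i, hi⟩ => (termPairs_unlisted i).2.2 hi

end Summit.CriticalPhenomena.PercolationContinuityZ3.Theorems.ThreePointVarianceRefutation
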